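import Mathlib
import Summits.ValiantsHypothesis.ValiantsHypothesis.Theses.LiouvilleSarnak

/-!
# Crux `LiouvilleSarnak.LiouvilleCutRank` (stmt-ValiantsHypothesis-14775) — line `one_scale`

Skeleton line (line-writer `linewriter-valiant-liouvmonotone-1-g0`, 2026-08-31).

The crux: `∀ W, ∃ n₀, ∀ n ≥ n₀, ∀ π` (balanced cut of the `2n` bit positions into `n` row bits and `n`
column bits), the `2^n × 2^n` matrix `M_π(r,c) = λ(N_π(r,c) + 1)` has rank `≥ W` (`λ` = Liouville,
`N_π(r,c) = Nat.ofBits (Sum.elim r c ∘ π.symm)`).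

THE CUT (scale transfer — the window method of the closed rungs `W = 4, 8`, done ONCE for every `W`):

* `stub_balancedWindow` (combinatorics of words, S–M, PROVABLE NOW): for `n ≥ n₁²`, every balanced
  row/column word of length `2n` has `2n₁` consecutive positions containing exactly `n₁` row letters.
  (Instance `K = 2n₁`, `c = n₁ - 1` of the landed counting lemma
  `Theorems.LiouvilleSarnakCutRankWindow.exists_window_count_btwn`: with `n = q n₁ + t`, `t < n₁ ≤ q`,
  its smallness hypothesis reads `(n₁-1) q + min (2t) (n₁-1) < q n₁ + t`.)
* `stub_windowEmbedding` (arithmetic of the embedding, M, PROVABLE NOW): if the window `[s, s+2n₁)` of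
  `π` is balanced, then for SOME balanced cut `π₁` at level `n₁` (the induced one) `rank M_{π₁} ≤ rank M_π`:
  set every bit below the window to `1`, every bit above to `0`; then `N_π + 1 = 2^s (N_{π₁} + 1)` and
  `λ(2^s x) = (-1)^s λ(x)` (`Theorems.LiouvilleSarnakAligned.liouville_two_pow_mul`), so `(-1)^s M_{π₁}`
  is a submatrix of `M_π` (cf. the landed `Theorems.LiouvilleSarnakCutRankWindow.card_le_rank_of_window`,
  which is this statement with a determinant certificate in place of `rank M_{π₁}`).
* `stub_rankAtOneScale` (OPEN — the arithmetic content, in its sharpest data-supported form): for every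
  `W` there is ONE level `n₁` at which EVERY balanced cut has rank `≥ W`.  Refuter data (item evidence,
  2026-08-17/27): the minimum of `rank M_{π₁}` over all balanced cuts at levels `n₁ = 1, …, 7` is
  `1, 3, 6, 15, 32, 64, 128` — full rank from `n₁ = 5` on; so `n₁ = 5` should certify `W ≤ 32` and
  `n₁ = 7` should certify `W ≤ 128` by finite computation (252, resp. 3432, sign matrices).
* `LiouvilleCutRank_of`: composition (kernel-checked): `n₀ = n₁ · n₁`.

TRANSFER (why the open stub is easier than the crux although it implies it): the crux asks for rank
`≥ W` at EVERY large level; the stub asks for it at ONE level of our choosing.  Every instance `W ≤ W₀`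
of the stub is a DECIDABLE finite statement (all balanced cuts of one level), so the rungs `W = 16, 32,
64, 128` need no new word-combinatorics (the `W = 4, 8` rungs each re-did it by hand), and for general
`W` one may pick convenient levels (`n₁` prime, `n₁ = 2^k`, …) and argue at a single scale (counting /
second-moment over cuts, distinct-row counting: a `±1` matrix of rank `< W` has `< 2^W` distinct rows).
-/

set_option linter.dupNamespace false

namespace Summit.ValiantsHypothesis.ValiantsHypothesis.Cruxes.LiouvilleCutRank.OneScale

open Summit.ValiantsHypothesis.ValiantsHypothesis.Theses.LiouvilleSarnak

/-- **Stub 1 — a balanced window exists (combinatorics of words; provable now from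
`Theorems.LiouvilleSarnakCutRankWindow.exists_window_count_btwn` with `K = 2n₁`, `c = n₁ - 1`).**
For `n ≥ n₁²`, the row/column word `w` of any balanced cut `π` of `2n` positions (`w j = true` iff
position `j` is a row bit) has a window of `2 n₁` consecutive positions with exactly `n₁` row bits.
[folklore] -/
theorem stub_balancedWindow :
    ∀ n₁ n : ℕ, n₁ * n₁ ≤ n → ∀ (π : Fin n ⊕ Fin n ≃ Fin (2 * n)) (w : ℕ → Bool),
      (∀ j : Fin (2 * n), w j = (π.symm j).isLeft) →
      ∃ s : ℕ, s + 2 * n₁ ≤ 2 * n ∧ Nat.count (fun k => w (s + k) = true) (2 * n₁) = n₁ := by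
  sorry

/-- **Stub 2 — window embedding (provable now; the arithmetic of
`Theorems.LiouvilleSarnakCutRankWindow.card_le_rank_of_window` with `rank` in place of a determinant
certificate).**  If the window `[s, s + 2n₁)` of the cut `π` contains exactly `n₁` row bits, then the
level-`n₁` Liouville cut matrix of the INDUCED cut `π₁` (some balanced cut at level `n₁`) has rank at most
that of `M_π`: freeze the bits below the window to `1` and above it to `0`; `N_π + 1 = 2^s (N_{π₁} + 1)`
and `λ(2^s x) = (-1)^s λ(x)`, so `± M_{π₁}` is a submatrix of `M_π`. [folklore] -/
theorem stub_windowEmbedding :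
    ∀ n₁ n : ℕ, ∀ (π : Fin n ⊕ Fin n ≃ Fin (2 * n)) (w : ℕ → Bool),
      (∀ j : Fin (2 * n), w j = (π.symm j).isLeft) →
      ∀ s : ℕ, s + 2 * n₁ ≤ 2 * n → Nat.count (fun k => w (s + k) = true) (2 * n₁) = n₁ →
      ∃ π₁ : Fin n₁ ⊕ Fin n₁ ≃ Fin (2 * n₁),
        (Matrix.of fun r c : Fin n₁ → Bool =>
          (((ArithmeticFunction.liouville
            (Nat.ofBits (fun j : Fin (2 * n₁) => Sum.elim r c (π₁.symm j)) + 1) : ℤ) : ℂ))).rank ≤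
        (Matrix.of fun r c : Fin n → Bool =>
          (((ArithmeticFunction.liouville
            (Nat.ofBits (fun j : Fin (2 * n) => Sum.elim r c (π.symm j)) + 1) : ℤ) : ℂ))).rank := by
  sorry

/-- **Stub 3 — full rank at one scale (OPEN; the arithmetic content).**  For every `W` there is a level
`n₁` at which EVERY balanced cut matrix has rank `≥ W`.  Data: the minimum rank over all balanced cuts at
levels `1..7` is `1, 3, 6, 15, 32, 64, 128` (refuter census on the item), so `W ≤ 128` is a finite
certificate at `n₁ = 7`; the general statement is the crux with its quantifier `∀ n ≥ n₀` collapsed to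
one level. [cite: Nisan1991Noncommutative] [cite: Mullner2017] -/
theorem stub_rankAtOneScale :
    ∀ W : ℕ, ∃ n₁ : ℕ, ∀ π₁ : Fin n₁ ⊕ Fin n₁ ≃ Fin (2 * n₁),
      W ≤ (Matrix.of fun r c : Fin n₁ → Bool =>
        (((ArithmeticFunction.liouville
          (Nat.ofBits (fun j : Fin (2 * n₁) => Sum.elim r c (π₁.symm j)) + 1) : ℤ) : ℂ))).rank := by
  sorry

/-- **Composition (kernel-checked).**  Fix `W`; take the level `n₁` of Stub 3 and `n₀ = n₁ · n₁`; for
`n ≥ n₀` and a cut `π`, Stub 1 gives a balanced window, Stub 2 an induced cut `π₁` with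
`rank M_{π₁} ≤ rank M_π`, and Stub 3 gives `W ≤ rank M_{π₁}`. [folklore] -/
theorem LiouvilleCutRank_of : LiouvilleCutRank := by
  intro W
  obtain ⟨n₁, hn₁⟩ := stub_rankAtOneScale W
  refine ⟨n₁ * n₁, fun n hn π => ?_⟩
  obtain ⟨s, hs, hcount⟩ :=
    stub_balancedWindow n₁ n hn π (fun k => if h : k < 2 * n then (π.symm ⟨k, h⟩).isLeft else false)
      (fun j => by simp [j.isLt])
  obtain ⟨π₁, hle⟩ :=
    stub_windowEmbedding n₁ n π (fun k => if h : k < 2 * n then (π.symm ⟨k, h⟩).isLeft else false)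
      (fun j => by simp [j.isLt]) s hs hcount
  exact (hn₁ π₁).trans hle

end Summit.ValiantsHypothesis.ValiantsHypothesis.Cruxes.LiouvilleCutRank.OneScale
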